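import Literature.InformationTheory.QuantumCodes.QuantumExpanderRobustnessNineTenths
import HarnessLib

/-!
# Robustness of quantum expander codes: LTZ15 Corollary 9 EXACTLY AS PRINTED (constant `1/3`, radius
# `min(γ_A n_A, γ_B n_B)`) for ALL degree pairs `(Δ_A, Δ_B)` — PROOF by the projection invariant

Index of sources: `[cite: LeverrierTillichZemor2015]` = Leverrier–Tillich–Zémor, FOCS 2015 / arXiv:1504.00822v1: Cor 9
"Robustness" (p0009 L9-11: "Any error `e` with reduced weight `w_R(e) < min(γ_A n_A, γ_B n_B)` has a syndrome with
weight bounded from below as `|σ(e)| ≥ (1/3) w_R(e)`"), its proof (p0009 L13-31), Lemma 7 (p0008 L95-98) with App. A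
(p0012: "Clearly `|E_A²| ≤ |E_A| ≤ w(e) ≤ γ_A n_A`"; "`|e| ≤ γ_B n_B`, Lemma 3 applies again, this time to the set
`E¹_{B,a}`"), Lemma 8 (p0008 L104-114) with App. B (p0013–p0014, eq. (reduced) and the four cases).

qec PARTITION v2 row 04 (`prover-qec-type-04`, gen 7), item «04.COR9» = successor (α) of finding E-7. The printed proof
of Cor 9 iterates Lemma 8 and needs its clause (ii) `w_R(e+e₁) ≤ w_R(e)` to keep every iterate inside the Lemma-7 ball
`|e| ≤ min(γ_A n_A, γ_B n_B)`; the printed case-4 argument for (ii) is complete only for near-balanced degrees (the tree: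
`ltz15_corollary9_near_balanced` under `|Δ_A − Δ_B| ≤ 5`, and `ltz15_corollary9_nine_tenths` at radius `9R/10` for all
degrees). THIS FILE proves the printed statement for every `(Δ_A, Δ_B)` by a different bookkeeping, which never looks
at the weight of the iterates:

* `exists_isCritical_of_proj` — Lemma 7 needs expansion only on the PROJECTIONS: a critical generator exists as soon as
  `|E_A²| ≤ γ_A n_A` and `|π₁(E ∩ B²)| ≤ γ_B n_B` (App. A applies Lemma 3 to `E_A²` and to `E¹_{B,a} ⊆ π₁(E ∩ B²)` only);
* `exists_flip_third_of_isCritical` — Lemma 8 (i) LOCALLY: for ANY word `e` (reduced or not) and any critical generator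
  `g_{ba}` at which `e` is locally minimal (`|e| ≤ |e ⊕ 𝟙(g_{ba})|`, which is all eq. (reduced) uses), one of the printed
  flips `F ⊆ g_{ba}` has `|F| ≤ 3(|σ_X(e)| − |σ_X(e ⊕ 𝟙_F)|)` (the tree's `ltz_four_cases`);
* the PROJECTION INVARIANT (`projA_supp_add_subset`, `projB_supp_add_subset`): every flip of the iteration and every
  local normalisation `e ↦ e ⊕ 𝟙(g_{ba})` lives in column `a` of `A²` and row `b` of `B²`; in the generic case
  (`x_a ≠ ∅ ≠ x_b`) already `a ∈ E_A²` and `b ∈ π₁(E ∩ B²)`, and in the degenerate cases (`x_a = ∅` or `x_b = ∅`) the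
  flip `x_a ∪ x_b ⊆ E` removes errors only (`card_le_decrease_of_degenerate`: its decrease is even `≥ |F|`). Hence
  BOTH PROJECTIONS ARE MONOTONE NON-INCREASING along the whole iteration, Lemma 7 and Lemma 8 (i) apply at every step,
  and `|σ_X(e)| ≥ (1/3)·Σ|F_i| ≥ w_R(e)/3` follows by induction on `(|σ_X(e)|, |e|)`
  (`exists_coset_word_le_three_of_proj`);
* ★ `ltz15_corollary9` — **Cor 9 exactly as printed, all degrees** (the signature of `ltz15_corollary9_near_balanced`
  without `|Δ_A − Δ_B| ≤ 5` and with `0 ≤ δ`; `ltz15_corollary9_all_degrees` is the literal drop-in with `0 < δ`);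
  `ltz15_corollary9_le` (radius `≤ R`), `ltz15_corollary9_proj` (hypothesis on the projections
  of some coset word only — weaker than `w_R(e) ≤ R`), `mem_rowSpace_of_syndrome_eq_zero_of_proj` (projection form of
  Cor 5: a zero-syndrome `X`-error with small projections is a `Z`-stabilizer element), `ltz15_corollary9_zsector`.

STATUS: `ltz15_corollary9` / `_le` / `_zsector` are the PRINTED statement (constant `1/3`, radius `R`, `δ_A, δ_B < 1/6`, with
`δ ≥ 0` in place of the implicit `δ > 0`); the PROOF (projection invariant) and the `_proj` forms are ours. Lemma 8
clause (ii) as printed is neither used nor claimed. PROVED (kernel axioms); no definitions, no named facts.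
-/

namespace Literature.InformationTheory.QuantumCodes

namespace QuantumExpander

open Finset Matrix

variable {A B : Type*} [Fintype A] [Fintype B] [DecidableEq A] [DecidableEq B]

/-! ### Projections: monotonicity and behaviour under flips inside one generator -/

omit [Fintype A] [Fintype B] [DecidableEq B] in
/-- `E ⊆ E' ⟹ E_A² ⊆ E'_A²`. [cite: LeverrierTillichZemor2015, App. A eq. (E_A^2) (arXiv v1 p0012 L20-23)] -/
theorem projA_mono {E E' : Finset ((A × A) ⊕ (B × B))} (h : E ⊆ E') : projA E ⊆ projA E' := by
  intro a ha
  rw [mem_projA] at ha ⊢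
  obtain ⟨α, hα⟩ := ha
  exact ⟨α, h hα⟩

omit [Fintype A] [Fintype B] [DecidableEq A] in
/-- `E ⊆ E' ⟹ π₁(E ∩ B²) ⊆ π₁(E' ∩ B²)`. [cite: LeverrierTillichZemor2015, App. A (arXiv v1 p0012 L38)] -/
theorem projB_mono {E E' : Finset ((A × A) ⊕ (B × B))} (h : E ⊆ E') : projB E ⊆ projB E' := by
  intro b hb
  rw [mem_projB] at hb ⊢
  obtain ⟨β, hβ⟩ := hb
  exact ⟨β, h hβ⟩

omit [Fintype A] [Fintype B] [DecidableEq A] in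
/-- `E¹_{B,a} ⊆ π₁(E ∩ B²)`: the rows of the `B²`-errors on the unique columns of `a` are rows of `B²`-errors.
[cite: LeverrierTillichZemor2015, App. A eq. (E^1_{B,a}) (arXiv v1 p0012 L47-50)] -/
theorem projBOn_subset_projB (E : Finset ((A × A) ⊕ (B × B))) (U : Finset B) : projBOn E U ⊆ projB E := by
  intro b hb
  rw [mem_projBOn] at hb
  rw [mem_projB]
  obtain ⟨β, -, hβ⟩ := hb
  exact ⟨β, hβ⟩

/-- `supp(e ⊕ 𝟙_F) ⊆ supp e ∪ F`. [cite: LeverrierTillichZemor2015, Cor 9 proof (the iterates e + e₁ + ⋯; arXiv v1 p0009 L17-22)] -/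
theorem supp_add_flipVec_subset (e : (A × A) ⊕ (B × B) → ZMod 2) (F : Finset ((A × A) ⊕ (B × B))) :
    supp (e + flipVec F) ⊆ supp e ∪ F := by
  classical
  intro q hq
  rw [Finset.mem_union]
  by_cases hF : q ∈ F
  · exact Or.inr hF
  · left
    have h : (e + flipVec F) q ≠ 0 := by simpa [supp] using hq
    rw [Pi.add_apply] at h
    have h0 : flipVec F q = 0 := by simp [flipVec, hF]
    rw [h0, add_zero] at h
    simpa [supp] using h

/-- `supp 𝟙_F = F`. [cite: FawziGrospellierLeverrier2018, §2.1 (indicator vectors)] -/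
theorem supp_flipVec (F : Finset ((A × A) ⊕ (B × B))) : supp (flipVec F) = F := by
  classical
  ext q
  simp [supp, flipVec]

/-- The generator `g_{ba}` lives in column `a` of `A²` and row `b` of `B²`: a qubit `αa'` of its support has `a' = a`.
[cite: LeverrierTillichZemor2015, §3 eq. (g_ba) (arXiv v1 p0007)] -/
theorem eq_of_inl_mem_genSupport {H : Matrix B A (ZMod 2)} {b : B} {a : A} {α a' : A}
    (h : Sum.inl (α, a') ∈ genSupport (expanderHZ H) (b, a)) : a' = a := by
  rw [genSupport, Finset.mem_filter, expanderHZ_row_apply_inl] at h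
  by_contra hne
  exact h.2 (by simp [Ne.symm hne])

/-- Second half: a qubit `b'β` of the support of `g_{ba}` has `b' = b`.
[cite: LeverrierTillichZemor2015, §3 eq. (g_ba) (arXiv v1 p0007)] -/
theorem eq_of_inr_mem_genSupport {H : Matrix B A (ZMod 2)} {b : B} {a : A} {b' β : B}
    (h : Sum.inr (b', β) ∈ genSupport (expanderHZ H) (b, a)) : b' = b := by
  rw [genSupport, Finset.mem_filter, expanderHZ_row_apply_inr] at h
  by_contra hne
  exact h.2 (by simp [Ne.symm hne])

/-- **Projection invariant, `A`-side**: adding to `e` a word `w` supported inside the generator `g_{ba}` (a flip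
`F ⊆ g_{ba}`, or `g_{ba}` itself) can only add the column `a` to `E_A²`.
[cite: LeverrierTillichZemor2015, App. A eq. (E_A^2) with §3 eq. (g_ba) (arXiv v1 p0012 L20-23, p0007)] -/
theorem projA_supp_add_subset (H : Matrix B A (ZMod 2)) (e w : (A × A) ⊕ (B × B) → ZMod 2) (b : B) (a : A)
    (hw : supp w ⊆ genSupport (expanderHZ H) (b, a)) :
    projA (supp (e + w)) ⊆ insert a (projA (supp e)) := by
  classical
  intro a' ha'
  rw [mem_projA] at ha'
  obtain ⟨α, hα⟩ := ha'
  rw [Finset.mem_insert]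
  by_cases hwq : w (Sum.inl (α, a')) = 0
  · right
    rw [mem_projA]
    refine ⟨α, ?_⟩
    have h : (e + w) (Sum.inl (α, a')) ≠ 0 := by simpa [supp] using hα
    rw [Pi.add_apply, hwq, add_zero] at h
    simpa [supp] using h
  · left
    have hq : Sum.inl (α, a') ∈ genSupport (expanderHZ H) (b, a) := hw (by simpa [supp] using hwq)
    exact eq_of_inl_mem_genSupport hq

/-- **Projection invariant, `B`-side**: adding a word supported inside `g_{ba}` can only add the row `b` to
`π₁(E ∩ B²)`. [cite: LeverrierTillichZemor2015, App. A (E^1_{B,a}; arXiv v1 p0012 L47-50) with §3 eq. (g_ba)] -/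
theorem projB_supp_add_subset (H : Matrix B A (ZMod 2)) (e w : (A × A) ⊕ (B × B) → ZMod 2) (b : B) (a : A)
    (hw : supp w ⊆ genSupport (expanderHZ H) (b, a)) :
    projB (supp (e + w)) ⊆ insert b (projB (supp e)) := by
  classical
  intro b' hb'
  rw [mem_projB] at hb'
  obtain ⟨β, hβ⟩ := hb'
  rw [Finset.mem_insert]
  by_cases hwq : w (Sum.inr (b', β)) = 0
  · right
    rw [mem_projB]
    refine ⟨β, ?_⟩
    have h : (e + w) (Sum.inr (b', β)) ≠ 0 := by simpa [supp] using hβ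
    rw [Pi.add_apply, hwq, add_zero] at h
    simpa [supp] using h
  · left
    have hq : Sum.inr (b', β) ∈ genSupport (expanderHZ H) (b, a) := hw (by simpa [supp] using hwq)
    exact eq_of_inr_mem_genSupport hq

omit [DecidableEq B] in
/-- In the generic case `x_a ≠ ∅` the column `a` of the critical generator is already a column of `E_A²`.
[cite: LeverrierTillichZemor2015, App. A ("choose a coordinate a ∈ E_A²"; arXiv v1 p0012 L40-41)] -/
theorem mem_projA_of_critX_nonempty {H : Matrix B A (ZMod 2)} {e : (A × A) ⊕ (B × B) → ZMod 2} {b : B} {a : A}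
    {Χa : Finset A} (h : (critX H e b a Χa).Nonempty) : a ∈ projA (supp e) := by
  obtain ⟨α, hα⟩ := h
  rw [mem_projA]
  exact ⟨α, by simpa [supp] using (mem_critX.1 hα).2⟩

omit [DecidableEq A] in
/-- In the generic case `x_b ≠ ∅` the row `b` of the critical generator is already a row of `π₁(E ∩ B²)`.
[cite: LeverrierTillichZemor2015, App. A ("there exists b ∈ E¹_{B,a}"; arXiv v1 p0012 L51-52)] -/
theorem mem_projB_of_critY_nonempty {H : Matrix B A (ZMod 2)} {e : (A × A) ⊕ (B × B) → ZMod 2} {b : B} {a : A}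
    {Χb : Finset B} (h : (critY H e b a Χb).Nonempty) : b ∈ projB (supp e) := by
  obtain ⟨β, hβ⟩ := h
  rw [mem_projB]
  exact ⟨β, by simpa [supp] using (mem_critY.1 hβ).2⟩

/-! ### Lemma 7 with expansion applied to the projections only -/

/-- **LTZ15 Lemma 7 / FGL18 Lemma 23, projection form.** For a `(Δ_A, Δ_B)`-biregular (`Δ ≥ 1`)
`(γ_A, δ_A, γ_B, δ_B)`-expanding graph with `δ_A, δ_B ≥ 0` and an error support `E ≠ ∅` whose PROJECTIONS satisfy
`|E_A²| ≤ γ_A n_A` and `|π₁(E ∩ B²)| ≤ γ_B n_B`, a critical generator exists. The printed hypothesis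
`|E| ≤ min(γ_A n_A, γ_B n_B)` is used in App. A only through these two projections ("Clearly `|E_A²| ≤ |E_A| ≤ w(e) ≤
γ_A n_A`"; "Lemma 3 applies again, this time to the set `E¹_{B,a}`", and `E¹_{B,a} ⊆ π₁(E ∩ B²)`). Proof: the tree's
`exists_isCritical` verbatim with the two cardinality steps replaced.
[cite: LeverrierTillichZemor2015, Lemma 7 (arXiv v1 p0008 L95-98) and App. A (p0012 L20-27, L44-52)] -/
theorem exists_isCritical_of_proj (H : Matrix B A (ZMod 2)) {dA dB : ℕ} {γA δA γB δB : ℝ}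
    (hreg : IsBiregular H dA dB) (hexp : IsLeftRightExpanding H dA dB γA δA γB δB)
    (hdA : 0 < dA) (hdB : 0 < dB) (hδA : 0 ≤ δA) (hδB : 0 ≤ δB)
    (E : Finset ((A × A) ⊕ (B × B))) (hE0 : E.Nonempty)
    (hEA : ((projA E).card : ℝ) ≤ γA * Fintype.card A) (hEB : ((projB E).card : ℝ) ≤ γB * Fintype.card B) :
    ∃ (b : B) (a : A) (Χa : Finset A) (Χb : Finset B), IsCritical H dA dB δA δB E b a Χa Χb := by
  classical
  have hdegA : ∀ a : A, (univ.filter fun b : B => H b a ≠ 0).card ≤ dA := fun a => (hreg.1 a).le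
  have hdegB : ∀ b : B, (univ.filter fun a : A => Hᵀ a b ≠ 0).card ≤ dB := fun b => by
    simpa [Matrix.transpose_apply] using (hreg.2 b).le
  have hexpT : IsLeftExpanding Hᵀ dB γB δB := (isLeftExpanding_transpose_iff H dB γB δB).2 hexp.2
  by_cases hSA : (projA E).Nonempty
  · -- Case `E_A ≠ ∅`: a column `a ∈ E_A²` with many unique neighbours
    obtain ⟨a, haS, haU⟩ := exists_card_uniqueNbrs_ge H hdegA hexp.1 (projA E) hSA hEA
    set Ua := uniqueNbrs H (projA E) a with hUa
    set Χb := nbrs H a \ Ua with hΧb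
    have hΧb_card : (Χb.card : ℝ) ≤ 2 * δA * dA := by
      have h1 : Χb.card = (nbrs H a).card - Ua.card :=
        Finset.card_sdiff_of_subset (uniqueNbrs_subset_nbrs H (projA E) a)
      have h2 : (nbrs H a).card = dA := card_nbrs_eq H hreg a
      have h3 : Ua.card ≤ (nbrs H a).card := Finset.card_le_card (uniqueNbrs_subset_nbrs H _ a)
      have h4 : (Χb.card : ℝ) = dA - Ua.card := by
        rw [h1, Nat.cast_sub h3, h2]
      rw [h4]; linarith
    have hclean_cols : nbrs H a \ Χb = Ua := by
      rw [hΧb, sdiff_sdiff_right_self, Finset.inf_eq_inter,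
        Finset.inter_eq_right.2 (uniqueNbrs_subset_nbrs H (projA E) a)]
    have hcolA : ∀ β ∈ Ua, ∀ (α : A) (a' : A), H β a' ≠ 0 → Sum.inl (α, a') ∈ E → a' = a := by
      intro β hβ α a' hH hE
      rw [hUa, mem_uniqueNbrs] at hβ
      exact hβ.2 a' (mem_projA.2 ⟨α, hE⟩) hH
    set T := projBOn E Ua with hT
    by_cases hT0 : T.Nonempty
    · -- generic case: a row `b ∈ E¹_{B,a}` with many unique neighbours; `E¹_{B,a} ⊆ π₁(E ∩ B²)`
      have hTcard : (T.card : ℝ) ≤ γB * Fintype.card B :=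
        le_trans (by exact_mod_cast Finset.card_le_card (projBOn_subset_projB E Ua)) hEB
      obtain ⟨b, hbT, hbU⟩ := exists_card_uniqueNbrs_ge Hᵀ hdegB hexpT T hT0 hTcard
      set Ub := uniqueNbrs Hᵀ T b with hUb
      set Χa := nbrs Hᵀ b \ Ub with hΧa
      have hΧa_card : (Χa.card : ℝ) ≤ 2 * δB * dB := by
        have h1 : Χa.card = (nbrs Hᵀ b).card - Ub.card :=
          Finset.card_sdiff_of_subset (uniqueNbrs_subset_nbrs Hᵀ T b)
        have h2 : (nbrs Hᵀ b).card = dB := card_nbrs_transpose_eq H hreg b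
        have h3 : Ub.card ≤ (nbrs Hᵀ b).card := Finset.card_le_card (uniqueNbrs_subset_nbrs Hᵀ T b)
        have h4 : (Χa.card : ℝ) = dB - Ub.card := by
          rw [h1, Nat.cast_sub h3, h2]
        rw [h4]; linarith
      have hclean_rows : nbrs Hᵀ b \ Χa = Ub := by
        rw [hΧa, sdiff_sdiff_right_self, Finset.inf_eq_inter,
          Finset.inter_eq_right.2 (uniqueNbrs_subset_nbrs Hᵀ T b)]
      refine ⟨b, a, Χa, Χb, ?_⟩
      refine ⟨Finset.sdiff_subset, Finset.sdiff_subset, hΧa_card, hΧb_card, ?_, ?_⟩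
      · intro α hα β hβ
        rw [hclean_rows] at hα
        rw [hclean_cols] at hβ
        refine ⟨fun a' hH hE => hcolA β hβ α a' hH hE, fun b' hH hE => ?_⟩
        rw [hUb, mem_uniqueNbrs] at hα
        have hb'T : b' ∈ T := by rw [hT, mem_projBOn]; exact ⟨β, hβ, hE⟩
        exact hα.2 b' hb'T (by simpa [Matrix.transpose_apply] using hH)
      · right
        have hb := hbT
        rw [hT, mem_projBOn] at hb
        obtain ⟨β, hβU, hβE⟩ := hb
        exact ⟨β, by rw [hclean_cols]; exact hβU, hβE⟩
    · -- `E_{B,a} = ∅`: any `b ∼ α₀` for an error qubit `α₀ a`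
      rw [Finset.not_nonempty_iff_eq_empty] at hT0
      obtain ⟨α₀, hα₀⟩ := mem_projA.1 haS
      have hcol : 0 < (univ.filter fun b : B => H b α₀ ≠ 0).card := by rw [hreg.1 α₀]; exact hdA
      obtain ⟨b, hb⟩ := Finset.card_pos.1 hcol
      rw [Finset.mem_filter] at hb
      refine ⟨b, a, ∅, Χb, ?_⟩
      refine ⟨Finset.empty_subset _, Finset.sdiff_subset, by simp; positivity, hΧb_card, ?_, ?_⟩
      · intro α hα β hβ
        rw [hclean_cols] at hβ
        refine ⟨fun a' hH hE => hcolA β hβ α a' hH hE, fun b' hH hE => ?_⟩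
        have hb'T : b' ∈ T := by rw [hT, mem_projBOn]; exact ⟨β, hβ, hE⟩
        rw [hT0] at hb'T
        exact absurd hb'T (Finset.notMem_empty _)
      · left
        refine ⟨α₀, ?_, hα₀⟩
        rw [Finset.sdiff_empty, mem_nbrs, Matrix.transpose_apply]
        exact hb.2
  · -- Case `E_A = ∅`: mirror image, a row `b` with many unique neighbours and any `a ∼ β₀`
    rw [Finset.not_nonempty_iff_eq_empty] at hSA
    have hnoA : ∀ (α a' : A), Sum.inl (α, a') ∉ E := by
      intro α a' h
      have : a' ∈ projA E := mem_projA.2 ⟨α, h⟩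
      rw [hSA] at this
      exact Finset.notMem_empty _ this
    have hSB : (projB E).Nonempty := by
      obtain ⟨q, hq⟩ := hE0
      rcases q with ⟨α, a'⟩ | ⟨b, β⟩
      · exact absurd hq (hnoA α a')
      · exact ⟨b, mem_projB.2 ⟨β, hq⟩⟩
    obtain ⟨b, hbS, hbU⟩ := exists_card_uniqueNbrs_ge Hᵀ hdegB hexpT (projB E) hSB hEB
    set Ub := uniqueNbrs Hᵀ (projB E) b with hUb
    set Χa := nbrs Hᵀ b \ Ub with hΧa
    have hΧa_card : (Χa.card : ℝ) ≤ 2 * δB * dB := by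
      have h1 : Χa.card = (nbrs Hᵀ b).card - Ub.card :=
        Finset.card_sdiff_of_subset (uniqueNbrs_subset_nbrs Hᵀ (projB E) b)
      have h2 : (nbrs Hᵀ b).card = dB := card_nbrs_transpose_eq H hreg b
      have h3 : Ub.card ≤ (nbrs Hᵀ b).card :=
        Finset.card_le_card (uniqueNbrs_subset_nbrs Hᵀ (projB E) b)
      have h4 : (Χa.card : ℝ) = dB - Ub.card := by
        rw [h1, Nat.cast_sub h3, h2]
      rw [h4]; linarith
    have hclean_rows : nbrs Hᵀ b \ Χa = Ub := by
      rw [hΧa, sdiff_sdiff_right_self, Finset.inf_eq_inter,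
        Finset.inter_eq_right.2 (uniqueNbrs_subset_nbrs Hᵀ (projB E) b)]
    obtain ⟨β₀, hβ₀⟩ := mem_projB.1 hbS
    have hrow : 0 < (univ.filter fun a : A => H β₀ a ≠ 0).card := by rw [hreg.2 β₀]; exact hdB
    obtain ⟨a, ha⟩ := Finset.card_pos.1 hrow
    rw [Finset.mem_filter] at ha
    refine ⟨b, a, Χa, ∅, ?_⟩
    refine ⟨Finset.sdiff_subset, Finset.empty_subset _, hΧa_card, by simp; positivity, ?_, ?_⟩
    · intro α hα β hβ
      rw [hclean_rows] at hα
      refine ⟨fun a' hH hE => absurd hE (hnoA α a'), fun b' hH hE => ?_⟩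
      rw [hUb, mem_uniqueNbrs] at hα
      exact hα.2 b' (mem_projB.2 ⟨β, hE⟩) (by simpa [Matrix.transpose_apply] using hH)
    · right
      refine ⟨β₀, ?_, hβ₀⟩
      rw [Finset.sdiff_empty, mem_nbrs]
      exact ha.2

/-! ### Lemma 8 (i), locally: the four cases at a critical generator where the word is locally minimal -/

omit [DecidableEq A] [DecidableEq B] in
/-- `|v| = |E ∩ A²| + |E ∩ B²|`. [folklore] -/
private theorem hammingNorm_eq_cardA_add_cardB' (v : (A × A) ⊕ (B × B) → ZMod 2) :
    hammingNorm v
      = (univ.filter fun p : A × A => v (Sum.inl p) ≠ 0).card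
        + (univ.filter fun p : B × B => v (Sum.inr p) ≠ 0).card := by
  simp only [hammingNorm]
  rw [Finset.card_filter, Finset.card_filter, Finset.card_filter, Fintype.sum_sum_type]

/-- A flip made of rows `S ⊆ Γ(b)` of column `a` and columns `T ⊆ Γ(a)` of row `b` lies inside `g_{ba}`.
[cite: LeverrierTillichZemor2015, §3 eq. (g_ba) (arXiv v1 p0007)] -/
theorem parts_subset_genSupport (H : Matrix B A (ZMod 2)) (b : B) (a : A) {S : Finset A} {T : Finset B}
    (hS : S ⊆ nbrs Hᵀ b) (hT : T ⊆ nbrs H a) :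
    S.image (fun α' => (Sum.inl (α', a) : (A × A) ⊕ (B × B))) ∪ T.image (fun β' => Sum.inr (b, β'))
      ⊆ genSupport (expanderHZ H) (b, a) := by
  intro q hq
  rw [genSupport, Finset.mem_filter]
  refine ⟨Finset.mem_univ _, ?_⟩
  rcases Finset.mem_union.1 hq with h | h
  · obtain ⟨α, hα, rfl⟩ := Finset.mem_image.1 h
    have := mem_nbrs.1 (hS hα)
    rw [Matrix.transpose_apply] at this
    simpa [expanderHZ, HypergraphProduct.xMatrix_apply_inl] using this
  · obtain ⟨β, hβ, rfl⟩ := Finset.mem_image.1 h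
    have := mem_nbrs.1 (hT hβ)
    simpa [expanderHZ, HypergraphProduct.xMatrix_apply_inr, Matrix.transpose_apply] using this

/-- Integrality of the `χ` bounds under `δ < 1/6`: `|χ| ≤ 2δΔ < Δ/3`, hence `3|χ| + 1 ≤ Δ` ("`3zΔ_B ≤ 3Δ_B − 1`").
[cite: LeverrierTillichZemor2015, App. B eq. (bound-z-t) (arXiv v1 p0013 L33-41)] -/
theorem three_mul_card_add_one_le {Χ : ℕ} {d : ℕ} {δ : ℝ} (hd : 0 < d) (hδ' : δ < 1 / 6)
    (hΧ : (Χ : ℝ) ≤ 2 * δ * d) : 3 * (Χ : ℝ) + 1 ≤ d := by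
  have h2 : (3 * Χ : ℝ) < d := by nlinarith [(show (0:ℝ) < d by exact_mod_cast hd)]
  have h3 : 3 * Χ < d := by exact_mod_cast h2
  have h4 : 3 * Χ + 1 ≤ d := h3
  exact_mod_cast h4

/-- **LTZ15 Lemma 8 (i), LOCAL form (all degrees).** Let `g_{ba}` be a critical generator for the support of ANY word
`e` (reduced or not) at which `e` is locally minimal, `|e| ≤ |e ⊕ 𝟙(g_{ba})|` — this is all that eq. (reduced)
`|x_a ∪ x_b| ≤ (Δ_A + Δ_B)/2` uses. Then one of the printed flips `x_a ∪ x_b`, `x̄_a ∪ x̄_b`,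
`x_a ∪ x_b ∪ χ_a ∪ χ_b` — a small set `F ⊆ g_{ba}` — satisfies `|F| ≤ 3(|σ_X(e)| − |σ_X(e ⊕ 𝟙_F)|)`. Proof: the tree's
`exists_smallSet_decrease_third` with the global minimal representative replaced by the local hypothesis (eqs. (partial),
(partial2), `ltz_four_cases`). [cite: LeverrierTillichZemor2015, Lemma 8 (arXiv v1 p0008 L104-110) and App. B (p0013 L10 – p0014 L50)] -/
theorem exists_flip_third_of_isCritical (H : Matrix B A (ZMod 2)) {dA dB : ℕ} {δA δB : ℝ}
    (hreg : IsBiregular H dA dB) (hdA : 0 < dA) (hdB : 0 < dB) (hδA' : δA < 1 / 6) (hδB' : δB < 1 / 6)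
    {e : (A × A) ⊕ (B × B) → ZMod 2} {b : B} {a : A} {Χa : Finset A} {Χb : Finset B}
    (hc : IsCritical H dA dB δA δB (supp e) b a Χa Χb)
    (hloc : hammingNorm e ≤ hammingNorm (e + expanderHZ H (b, a))) :
    ∃ F ∈ smallSets (expanderHZ H), F ⊆ genSupport (expanderHZ H) (b, a) ∧
      (F.card : ℝ) ≤ 3 * syndromeDecrease (expanderHX H) (expanderHX H *ᵥ e) F := by
  classical
  -- the index sets
  set Xa := critX H e b a Χa with hXa
  set Yb := critY H e b a Χb with hYb
  set Xbar := (nbrs Hᵀ b \ Χa).filter fun α => e (Sum.inl (α, a)) = 0 with hXbar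
  set Ybar := (nbrs H a \ Χb).filter fun β => e (Sum.inr (b, β)) = 0 with hYbar
  have hXbar_sub : Xbar ⊆ nbrs Hᵀ b := fun α h => (Finset.mem_sdiff.1 (Finset.mem_filter.1 h).1).1
  have hYbar_sub : Ybar ⊆ nbrs H a := fun β h => (Finset.mem_sdiff.1 (Finset.mem_filter.1 h).1).1
  -- row / column sums
  have hXbar' : (nbrs Hᵀ b \ Χa).filter (fun α => ¬ (e (Sum.inl (α, a)) ≠ 0)) = Xbar :=
    Finset.filter_congr (fun α _ => by rw [not_not])
  have hYbar' : (nbrs H a \ Χb).filter (fun β => ¬ (e (Sum.inr (b, β)) ≠ 0)) = Ybar :=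
    Finset.filter_congr (fun β _ => by rw [not_not])
  have hΧa_le : Χa.card ≤ dB := by
    have := Finset.card_le_card hc.Χa_subset; rwa [card_nbrs_transpose_eq H hreg b] at this
  have hΧb_le : Χb.card ≤ dA := by
    have := Finset.card_le_card hc.Χb_subset; rwa [card_nbrs_eq H hreg a] at this
  have hrow : (Xa.card : ℝ) + Xbar.card + Χa.card = dB := by
    have h1 : Xa.card + Xbar.card = (nbrs Hᵀ b \ Χa).card := by
      rw [← hXbar', hXa, critX]; exact Finset.card_filter_add_card_filter_not _
    have h2 : (nbrs Hᵀ b \ Χa).card = dB - Χa.card := by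
      rw [Finset.card_sdiff_of_subset hc.Χa_subset, card_nbrs_transpose_eq H hreg b]
    have h3 : ((Xa.card + Xbar.card : ℕ) : ℝ) = ((dB - Χa.card : ℕ) : ℝ) := by rw [h1, h2]
    rw [Nat.cast_sub hΧa_le] at h3; push_cast at h3; linarith
  have hcol : (Yb.card : ℝ) + Ybar.card + Χb.card = dA := by
    have h1 : Yb.card + Ybar.card = (nbrs H a \ Χb).card := by
      rw [← hYbar', hYb, critY]; exact Finset.card_filter_add_card_filter_not _
    have h2 : (nbrs H a \ Χb).card = dA - Χb.card := by
      rw [Finset.card_sdiff_of_subset hc.Χb_subset, card_nbrs_eq H hreg a]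
    have h3 : ((Yb.card + Ybar.card : ℕ) : ℝ) = ((dA - Χb.card : ℕ) : ℝ) := by rw [h1, h2]
    rw [Nat.cast_sub hΧb_le] at h3; push_cast at h3; linarith
  -- integrality of the `χ` bounds: `3|χ_a| + 1 ≤ Δ_B`
  have hZa3 : 3 * (Χa.card : ℝ) + 1 ≤ dB := three_mul_card_add_one_le hdB hδB' hc.card_Χa_le
  have hZb3 : 3 * (Χb.card : ℝ) + 1 ≤ dA := three_mul_card_add_one_le hdA hδA' hc.card_Χb_le
  -- local minimality: `2 (|x_a| + |x_b|) ≤ Δ_A + Δ_B`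
  have hred : 2 * ((Xa.card : ℝ) + Yb.card) ≤ dA + dB := by
    have hA := cardA_add_row H hreg e b a
    have hB := cardB_add_row H hreg e b a
    have hmin' := hloc
    rw [hammingNorm_eq_cardA_add_cardB', hammingNorm_eq_cardA_add_cardB'] at hmin'
    have hXle : Xa.card ≤ ((nbrs Hᵀ b).filter fun α => e (Sum.inl (α, a)) ≠ 0).card := by
      refine Finset.card_le_card fun α hα => ?_
      rw [hXa, mem_critX] at hα
      rw [Finset.mem_filter, mem_nbrs, Matrix.transpose_apply]
      exact ⟨hα.1.1, hα.2⟩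
    have hYle : Yb.card ≤ ((nbrs H a).filter fun β => e (Sum.inr (b, β)) ≠ 0).card := by
      refine Finset.card_le_card fun β hβ => ?_
      rw [hYb, mem_critY] at hβ
      rw [Finset.mem_filter, mem_nbrs]
      exact ⟨hβ.1.1, hβ.2⟩
    have : 2 * (Xa.card + Yb.card) ≤ dA + dB := by omega
    exact_mod_cast this
  -- the two decrease bounds
  have hP := syndromeDecrease_critFlip_ge hreg hc
  have hQ := syndromeDecrease_flipBar_ge hc
  set F := critFlip H e b a Χa Χb with hF
  set G := Xbar.image (fun α' => (Sum.inl (α', a) : (A × A) ⊕ (B × B)))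
    ∪ Ybar.image (fun β' => Sum.inr (b, β')) with hG
  set G' := (nbrs Hᵀ b \ Xbar).image (fun α' => (Sum.inl (α', a) : (A × A) ⊕ (B × B)))
    ∪ (nbrs H a \ Ybar).image (fun β' => Sum.inr (b, β')) with hG'
  set P : ℝ := ((syndromeDecrease (expanderHX H) (expanderHX H *ᵥ e) F : ℤ) : ℝ) with hPdef
  set Q : ℝ := ((syndromeDecrease (expanderHX H) (expanderHX H *ᵥ e) G : ℤ) : ℝ) with hQdef
  have hP' : (Xa.card : ℝ) * Ybar.card + Xbar.card * Yb.card - Xa.card * Χb.card - Χa.card * Yb.card ≤ P := by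
    have h1 : ((Xa.card : ℤ) * ((dA : ℤ) - Χb.card - Yb.card) + ((dB : ℤ) - Χa.card - Xa.card) * Yb.card
        - Xa.card * Χb.card - Χa.card * Yb.card : ℝ)
        ≤ (syndromeDecrease (expanderHX H) (expanderHX H *ᵥ e) F : ℝ) := by exact_mod_cast hP
    have hYbar_e : (Ybar.card : ℝ) = dA - Χb.card - Yb.card := by linarith
    have hXbar_e : (Xbar.card : ℝ) = dB - Χa.card - Xa.card := by linarith
    rw [hPdef, hYbar_e, hXbar_e]
    push_cast at h1
    linarith
  have hQ' : (Xa.card : ℝ) * Ybar.card + Xbar.card * Yb.card - Xbar.card * Χb.card - Χa.card * Ybar.card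
      ≤ Q := by
    rw [hQdef]; exact_mod_cast hQ
  -- the case analysis
  have hcases := ltz_four_cases (P := P) (Q := Q) (by exact_mod_cast hdA) (by exact_mod_cast hdB)
    (Nat.cast_nonneg Xa.card) (Nat.cast_nonneg Xbar.card) (Nat.cast_nonneg Yb.card)
    (Nat.cast_nonneg Ybar.card) hrow hcol hZa3 hZb3 hred hP' hQ'
  -- `x̄_a ∪ x̄_b` is non-empty (else local minimality fails), and the sizes of the three candidates
  have hbar_pos : (1 : ℝ) ≤ Xbar.card + Ybar.card := by
    by_contra hlt
    push Not at hlt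
    have h0 : Xbar.card + Ybar.card = 0 := by
      by_contra hne
      have : 1 ≤ Xbar.card + Ybar.card := Nat.one_le_iff_ne_zero.2 hne
      have : (1 : ℝ) ≤ Xbar.card + Ybar.card := by exact_mod_cast this
      linarith
    have hXb0 : (Xbar.card : ℝ) = 0 := by exact_mod_cast (by omega : Xbar.card = 0)
    have hYb0 : (Ybar.card : ℝ) = 0 := by exact_mod_cast (by omega : Ybar.card = 0)
    nlinarith
  have hcardF : (F.card : ℝ) = Xa.card + Yb.card := by
    rw [hF]; exact_mod_cast card_critFlip H e b a Χa Χb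
  have hcardG : (G.card : ℝ) = Xbar.card + Ybar.card := by
    rw [hG]; exact_mod_cast card_flipVec_parts b a Xbar Ybar
  have hcardG' : (G'.card : ℝ) = dA + dB - Xbar.card - Ybar.card := by
    have h1 := card_flipVec_parts (A := A) (B := B) b a (nbrs Hᵀ b \ Xbar) (nbrs H a \ Ybar)
    rw [Finset.card_sdiff_of_subset hXbar_sub, Finset.card_sdiff_of_subset hYbar_sub,
      card_nbrs_transpose_eq H hreg b, card_nbrs_eq H hreg a] at h1
    have hXbar_le : Xbar.card ≤ dB := by
      have := Finset.card_le_card hXbar_sub; rwa [card_nbrs_transpose_eq H hreg b] at this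
    have hYbar_le : Ybar.card ≤ dA := by
      have := Finset.card_le_card hYbar_sub; rwa [card_nbrs_eq H hreg a] at this
    rw [hG']
    have h2 : (G'.card : ℝ) = ((dB - Xbar.card + (dA - Ybar.card) : ℕ) : ℝ) := by
      rw [hG']; exact_mod_cast h1
    rw [hG'] at h2
    rw [h2, Nat.cast_add, Nat.cast_sub hXbar_le, Nat.cast_sub hYbar_le]
    ring
  have hQG' : (syndromeDecrease (expanderHX H) (expanderHX H *ᵥ e) G' : ℝ) = Q := by
    rw [hQdef, hG', hG]
    exact_mod_cast syndromeDecrease_parts_compl H b a (expanderHX H *ᵥ e) hXbar_sub hYbar_sub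
  rcases hcases with h | h | h
  · exact ⟨F, critFlip_mem_smallSets hc, critFlip_subset_genSupport H e b a Χa Χb, by rw [hcardF]; linarith⟩
  · refine ⟨G, ?_, parts_subset_genSupport H b a hXbar_sub hYbar_sub, by rw [hcardG]; linarith⟩
    refine flipVec_parts_mem_smallSets H b a hXbar_sub hYbar_sub ?_
    by_contra hne
    rw [not_or, Finset.not_nonempty_iff_eq_empty, Finset.not_nonempty_iff_eq_empty] at hne
    rw [hne.1, hne.2] at hbar_pos
    norm_num at hbar_pos
  · refine ⟨G', ?_, parts_subset_genSupport H b a Finset.sdiff_subset Finset.sdiff_subset,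
      by rw [hQG', hcardG']; linarith⟩
    refine flipVec_parts_mem_smallSets H b a Finset.sdiff_subset Finset.sdiff_subset ?_
    -- `x_a ∪ x_b ≠ ∅` lies inside the complement flip
    rcases hc.nonempty with ⟨α, hα, hE⟩ | ⟨β, hβ, hE⟩
    · left
      refine ⟨α, Finset.mem_sdiff.2 ⟨(Finset.mem_sdiff.1 hα).1, fun h => ?_⟩⟩
      have := (Finset.mem_filter.1 h).2
      have hne : e (Sum.inl (α, a)) ≠ 0 := by simpa [supp] using hE
      exact hne this
    · right
      refine ⟨β, Finset.mem_sdiff.2 ⟨(Finset.mem_sdiff.1 hβ).1, fun h => ?_⟩⟩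
      have := (Finset.mem_filter.1 h).2
      have hne : e (Sum.inr (b, β)) ≠ 0 := by simpa [supp] using hE
      exact hne this

/-- **The degenerate cases `x_b = ∅` or `x_a = ∅`**: there the flip `F = x_a ∪ x_b ⊆ E` alone decreases the syndrome by
at least `|x_a|(Δ_A − 2|χ_b|) + |x_b|(Δ_B − 2|χ_a|) ≥ |F|` (every clean check of a flipped row/column reads `1`), with no
local-minimality hypothesis: eq. (partial) `∂ ≥ |x_a||x̄_b| + |x̄_a||x_b| − |x_a||χ_b| − |χ_a||x_b|` with `x̄_b = Γ(a) ∖ χ_b`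
(resp. `x̄_a = Γ(b) ∖ χ_a`). [cite: LeverrierTillichZemor2015, App. B eq. (partial) (arXiv v1 p0013 L78-90) with App. A, case E_{B,a} = ∅ (p0012 L28-37, L43)] -/
theorem card_le_decrease_of_degenerate (H : Matrix B A (ZMod 2)) {dA dB : ℕ} {δA δB : ℝ}
    (hreg : IsBiregular H dA dB) (hdA : 0 < dA) (hdB : 0 < dB) (hδA' : δA < 1 / 6) (hδB' : δB < 1 / 6)
    {e : (A × A) ⊕ (B × B) → ZMod 2} {b : B} {a : A} {Χa : Finset A} {Χb : Finset B}
    (hc : IsCritical H dA dB δA δB (supp e) b a Χa Χb)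
    (hdeg : critX H e b a Χa = ∅ ∨ critY H e b a Χb = ∅) :
    ((critFlip H e b a Χa Χb).card : ℝ)
      ≤ syndromeDecrease (expanderHX H) (expanderHX H *ᵥ e) (critFlip H e b a Χa Χb) := by
  have hP := syndromeDecrease_critFlip_ge hreg hc
  have hZa3 : 3 * (Χa.card : ℝ) + 1 ≤ dB := three_mul_card_add_one_le hdB hδB' hc.card_Χa_le
  have hZb3 : 3 * (Χb.card : ℝ) + 1 ≤ dA := three_mul_card_add_one_le hdA hδA' hc.card_Χb_le
  have hcardF : ((critFlip H e b a Χa Χb).card : ℝ) = (critX H e b a Χa).card + (critY H e b a Χb).card := by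
    exact_mod_cast card_critFlip H e b a Χa Χb
  have hP' : ((critX H e b a Χa).card : ℝ) * ((dA : ℝ) - Χb.card - (critY H e b a Χb).card)
        + ((dB : ℝ) - Χa.card - (critX H e b a Χa).card) * (critY H e b a Χb).card
        - (critX H e b a Χa).card * Χb.card - Χa.card * (critY H e b a Χb).card
      ≤ syndromeDecrease (expanderHX H) (expanderHX H *ᵥ e) (critFlip H e b a Χa Χb) := by
    have h1 := hP
    have : (((critX H e b a Χa).card : ℤ) * ((dA : ℤ) - Χb.card - (critY H e b a Χb).card)
        + ((dB : ℤ) - Χa.card - (critX H e b a Χa).card) * (critY H e b a Χb).card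
        - (critX H e b a Χa).card * Χb.card - Χa.card * (critY H e b a Χb).card : ℝ)
        ≤ (syndromeDecrease (expanderHX H) (expanderHX H *ᵥ e) (critFlip H e b a Χa Χb) : ℝ) := by
      exact_mod_cast h1
    push_cast at this
    linarith
  have hX0 : (0 : ℝ) ≤ (critX H e b a Χa).card := Nat.cast_nonneg _
  have hY0 : (0 : ℝ) ≤ (critY H e b a Χb).card := Nat.cast_nonneg _
  rcases hdeg with h | h
  · have hX : ((critX H e b a Χa).card : ℝ) = 0 := by rw [h]; simp
    rw [hX] at hP' hcardF
    rw [hcardF]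
    nlinarith
  · have hY : ((critY H e b a Χb).card : ℝ) = 0 := by rw [h]; simp
    rw [hY] at hP' hcardF
    rw [hcardF]
    nlinarith

/-! ### The iteration with the projection invariant -/

/-- Bookkeeping of one flip step (as in the printed proof: `|e| ≤ |e₁| + ⋯` and `|σ_X(e)| − |σ_X(e+e₁)| ≥ |e₁|/3`): if
`F` has `|F| ≤ 3·(decrease)` and the flipped word `e ⊕ 𝟙_F` has a coset word `v'` with `|v'| ≤ 3|σ_X(e ⊕ 𝟙_F)|`, then
`v' ⊕ 𝟙_F` is a coset word of `e` with `|v' ⊕ 𝟙_F| ≤ 3|σ_X(e)|`.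
[cite: LeverrierTillichZemor2015, Cor 9 proof eq. (1/6) (arXiv v1 p0009 L21-25)] -/
theorem coset_word_flip_step (H : Matrix B A (ZMod 2)) {e v' : (A × A) ⊕ (B × B) → ZMod 2}
    {F : Finset ((A × A) ⊕ (B × B))}
    (hF3 : (F.card : ℝ) ≤ 3 * syndromeDecrease (expanderHX H) (expanderHX H *ᵥ e) F)
    (hv' : v' + (e + flipVec F) ∈ rowSpace (expanderHZ H))
    (hw' : hammingNorm v' ≤ 3 * hammingNorm (expanderHX H *ᵥ (e + flipVec F))) :
    (v' + flipVec F) + e ∈ rowSpace (expanderHZ H) ∧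
      hammingNorm (v' + flipVec F) ≤ 3 * hammingNorm (expanderHX H *ᵥ e) := by
  constructor
  · have : v' + flipVec F + e = v' + (e + flipVec F) := by abel
    rw [this]; exact hv'
  · have h1 := hammingNorm_add_flipVec v' F
    have h2 : (hammingNorm (expanderHX H *ᵥ (e + flipVec F)) : ℤ)
        = hammingNorm (expanderHX H *ᵥ e) - syndromeDecrease (expanderHX H) (expanderHX H *ᵥ e) F := by
      rw [Matrix.mulVec_add, syndromeDecrease]; ring
    have h3 : ((hammingNorm (v' + flipVec F) : ℕ) : ℝ) ≤ hammingNorm v' + F.card := by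
      exact_mod_cast (by omega : hammingNorm (v' + flipVec F) ≤ hammingNorm v' + F.card)
    have h4 : ((hammingNorm v' : ℕ) : ℝ) ≤ 3 * hammingNorm (expanderHX H *ᵥ (e + flipVec F)) := by
      exact_mod_cast hw'
    have h5 : ((hammingNorm (expanderHX H *ᵥ (e + flipVec F)) : ℕ) : ℝ)
        = hammingNorm (expanderHX H *ᵥ e) - syndromeDecrease (expanderHX H) (expanderHX H *ᵥ e) F := by
      exact_mod_cast h2
    have : ((hammingNorm (v' + flipVec F) : ℕ) : ℝ) ≤ 3 * hammingNorm (expanderHX H *ᵥ e) := by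
      rw [h5] at h4; linarith
    exact_mod_cast this

/-- The termination measure of the iteration drops at a flip step: the syndrome weight decreases by a positive integer
(the decrease is `≥ |F|/3 > 0`), whatever the Hamming weight of the new word.
[cite: LeverrierTillichZemor2015, Cor 9 proof ("iterate … until the syndrome weight reaches 0"; arXiv v1 p0009 L17-20)] -/
theorem measure_lt_of_flip (H : Matrix B A (ZMod 2)) {e : (A × A) ⊕ (B × B) → ZMod 2}
    {F : Finset ((A × A) ⊕ (B × B))} (hF : F ∈ smallSets (expanderHZ H))
    (hF3 : (F.card : ℝ) ≤ 3 * syndromeDecrease (expanderHX H) (expanderHX H *ᵥ e) F) :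
    hammingNorm (expanderHX H *ᵥ (e + flipVec F)) * (Fintype.card ((A × A) ⊕ (B × B)) + 1)
        + hammingNorm (e + flipVec F)
      < hammingNorm (expanderHX H *ᵥ e) * (Fintype.card ((A × A) ⊕ (B × B)) + 1) + hammingNorm e := by
  obtain ⟨hsyn, hwt, hdec⟩ := syndrome_step_bookkeeping H (e' := e + flipVec F) hF hF3 (by simp)
  set N := Fintype.card ((A × A) ⊕ (B × B)) with hN
  have hle : hammingNorm (e + flipVec F) ≤ N := hammingNorm_le_card_fintype
  have h1 : hammingNorm (expanderHX H *ᵥ (e + flipVec F)) + 1 ≤ hammingNorm (expanderHX H *ᵥ e) := by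
    have : (hammingNorm (expanderHX H *ᵥ (e + flipVec F)) : ℤ) + 1 ≤ hammingNorm (expanderHX H *ᵥ e) := by
      linarith
    exact_mod_cast this
  have h2 := Nat.mul_le_mul_right (N + 1) h1
  have h3 : (hammingNorm (expanderHX H *ᵥ (e + flipVec F)) + 1) * (N + 1)
      = hammingNorm (expanderHX H *ᵥ (e + flipVec F)) * (N + 1) + (N + 1) := by ring
  rw [h3] at h2
  omega

/-- **The projection iteration** (the heart of this file). For a `(Δ_A,Δ_B)`-biregular `(γ_A,δ_A,γ_B,δ_B)`-expander with
`0 ≤ δ_A, δ_B < 1/6` and ANY degrees: every word `e` whose projections satisfy `|E_A²| ≤ γ_A n_A` and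
`|π₁(E ∩ B²)| ≤ γ_B n_B` has a coset word `e' ∈ e + C_Z^⊥` with `|e'| ≤ 3|σ_X(e)|`. Induction on
`(|σ_X(e)|, |e|)`: if `e ≠ 0`, take a critical generator `g_{ba}` (`exists_isCritical_of_proj`); in the degenerate cases flip
`x_a ∪ x_b ⊆ E` (`card_le_decrease_of_degenerate`); otherwise `a ∈ E_A²`, `b ∈ π₁(E ∩ B²)`, and either `e` is not locally
minimal at `g_{ba}` — replace `e` by the lighter coset word `e ⊕ 𝟙(g_{ba})` (same syndrome) — or Lemma 8 (i) gives a flip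
`F ⊆ g_{ba}` (`exists_flip_third_of_isCritical`); in every case the projections do not grow (`projA_supp_add_subset`,
`projB_supp_add_subset`), so the induction hypothesis applies, and the flip steps compose by `coset_word_flip_step`.
STATUS: OUR proof architecture for the printed Cor 9. [cite: LeverrierTillichZemor2015, Cor 9 and its proof (arXiv v1 p0009 L9-31), Lemma 7 / App. A (p0012)] -/
theorem exists_coset_word_le_three_of_proj (H : Matrix B A (ZMod 2)) {dA dB : ℕ} {γA δA γB δB : ℝ}
    (hreg : IsBiregular H dA dB) (hexp : IsLeftRightExpanding H dA dB γA δA γB δB)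
    (hdA : 0 < dA) (hdB : 0 < dB) (hδA : 0 ≤ δA) (hδA' : δA < 1 / 6) (hδB : 0 ≤ δB) (hδB' : δB < 1 / 6)
    (e : (A × A) ⊕ (B × B) → ZMod 2)
    (heA : ((projA (supp e)).card : ℝ) ≤ γA * Fintype.card A)
    (heB : ((projB (supp e)).card : ℝ) ≤ γB * Fintype.card B) :
    ∃ e' : (A × A) ⊕ (B × B) → ZMod 2, e' + e ∈ rowSpace (expanderHZ H) ∧
      hammingNorm e' ≤ 3 * hammingNorm (expanderHX H *ᵥ e) := by
  classical
  set N := Fintype.card ((A × A) ⊕ (B × B)) with hN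
  -- strong induction on the measure `|σ_X(e)|·(N+1) + |e|`
  suffices h : ∀ n : ℕ, ∀ f : (A × A) ⊕ (B × B) → ZMod 2,
      hammingNorm (expanderHX H *ᵥ f) * (N + 1) + hammingNorm f ≤ n →
      ((projA (supp f)).card : ℝ) ≤ γA * Fintype.card A →
      ((projB (supp f)).card : ℝ) ≤ γB * Fintype.card B →
      ∃ e' : (A × A) ⊕ (B × B) → ZMod 2, e' + f ∈ rowSpace (expanderHZ H) ∧
        hammingNorm e' ≤ 3 * hammingNorm (expanderHX H *ᵥ f) from
    h _ e le_rfl heA heB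
  intro n
  induction n with
  | zero =>
    intro f hf _ _
    have hf0 : hammingNorm f = 0 := by omega
    have hfz : f = 0 := hammingNorm_eq_zero.1 hf0
    refine ⟨0, ?_, by simp⟩
    rw [hfz, add_zero]; exact Submodule.zero_mem _
  | succ n ih =>
    intro f hf hfA hfB
    by_cases hfz : f = 0
    · refine ⟨0, ?_, by simp⟩
      rw [hfz, add_zero]; exact Submodule.zero_mem _
    -- a critical generator for the support of `f`
    have hE0 : (supp f).Nonempty := by
      by_contra h0
      rw [Finset.not_nonempty_iff_eq_empty] at h0
      apply hfz
      ext q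
      by_contra hq
      have : q ∈ supp f := by simpa [supp] using hq
      rw [h0] at this
      exact Finset.notMem_empty _ this
    obtain ⟨b, a, Χa, Χb, hc⟩ := exists_isCritical_of_proj H hreg hexp hdA hdB hδA hδB (supp f) hE0 hfA hfB
    by_cases hdeg : critX H f b a Χa = ∅ ∨ critY H f b a Χb = ∅
    · -- degenerate cases: flip `x_a ∪ x_b ⊆ E`
      set F := critFlip H f b a Χa Χb with hF
      have hFs : F ∈ smallSets (expanderHZ H) := critFlip_mem_smallSets hc
      have hdecF := card_le_decrease_of_degenerate H hreg hdA hdB hδA' hδB' hc hdeg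
      have hF3 : (F.card : ℝ) ≤ 3 * syndromeDecrease (expanderHX H) (expanderHX H *ᵥ f) F := by
        have : (0 : ℝ) ≤ F.card := Nat.cast_nonneg _
        rw [hF]; linarith
      have hsub : supp (f + flipVec F) ⊆ supp f := by
        refine (supp_add_flipVec_subset f F).trans ?_
        rw [Finset.union_subset_iff]
        exact ⟨le_rfl, critFlip_subset_supp H f b a Χa Χb⟩
      have hlt := measure_lt_of_flip H hFs hF3
      rw [← hN] at hlt
      obtain ⟨v', hv', hwv'⟩ := ih (f + flipVec F) (by omega)
        (le_trans (by exact_mod_cast Finset.card_le_card (projA_mono hsub)) hfA)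
        (le_trans (by exact_mod_cast Finset.card_le_card (projB_mono hsub)) hfB)
      exact ⟨v' + flipVec F, coset_word_flip_step H hF3 hv' hwv'⟩
    · -- generic case: `a ∈ E_A²`, `b ∈ π₁(E ∩ B²)`
      rw [not_or] at hdeg
      have haP : a ∈ projA (supp f) :=
        mem_projA_of_critX_nonempty (Finset.nonempty_iff_ne_empty.2 hdeg.1)
      have hbP : b ∈ projB (supp f) :=
        mem_projB_of_critY_nonempty (Finset.nonempty_iff_ne_empty.2 hdeg.2)
      have hinsA : insert a (projA (supp f)) = projA (supp f) := Finset.insert_eq_of_mem haP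
      have hinsB : insert b (projB (supp f)) = projB (supp f) := Finset.insert_eq_of_mem hbP
      by_cases hloc : hammingNorm f ≤ hammingNorm (f + expanderHZ H (b, a))
      · -- Lemma 8 (i) locally: a flip inside `g_{ba}`
        obtain ⟨F, hFs, hFg, hF3⟩ := exists_flip_third_of_isCritical H hreg hdA hdB hδA' hδB' hc hloc
        have hsuppF : supp (flipVec F) ⊆ genSupport (expanderHZ H) (b, a) := by rw [supp_flipVec]; exact hFg
        have hA' : projA (supp (f + flipVec F)) ⊆ projA (supp f) := by
          rw [← hinsA]; exact projA_supp_add_subset H f (flipVec F) b a hsuppF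
        have hB' : projB (supp (f + flipVec F)) ⊆ projB (supp f) := by
          rw [← hinsB]; exact projB_supp_add_subset H f (flipVec F) b a hsuppF
        have hlt := measure_lt_of_flip H hFs hF3
        rw [← hN] at hlt
        obtain ⟨v', hv', hwv'⟩ := ih (f + flipVec F) (by omega)
          (le_trans (by exact_mod_cast Finset.card_le_card hA') hfA)
          (le_trans (by exact_mod_cast Finset.card_le_card hB') hfB)
        exact ⟨v' + flipVec F, coset_word_flip_step H hF3 hv' hwv'⟩
      · -- not locally minimal: pass to the lighter coset word `f ⊕ 𝟙(g_{ba})` (same syndrome, same projections)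
        push Not at hloc
        set g : (A × A) ⊕ (B × B) → ZMod 2 := expanderHZ H (b, a) with hg
        have hgmem : g ∈ rowSpace (expanderHZ H) := expanderHZ_row_mem_rowSpace H b a
        have hsyn : expanderHX H *ᵥ (f + g) = expanderHX H *ᵥ f := by
          rw [Matrix.mulVec_add, expanderHX_mulVec_eq_zero_of_mem_rowSpace H hgmem, add_zero]
        have hsuppg : supp g ⊆ genSupport (expanderHZ H) (b, a) := by
          intro q hq; simpa [supp, genSupport] using hq
        have hA' : projA (supp (f + g)) ⊆ projA (supp f) := by
          rw [← hinsA]; exact projA_supp_add_subset H f g b a hsuppg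
        have hB' : projB (supp (f + g)) ⊆ projB (supp f) := by
          rw [← hinsB]; exact projB_supp_add_subset H f g b a hsuppg
        obtain ⟨v', hv', hwv'⟩ := ih (f + g) (by rw [hsyn]; omega)
          (le_trans (by exact_mod_cast Finset.card_le_card hA') hfA)
          (le_trans (by exact_mod_cast Finset.card_le_card hB') hfB)
        refine ⟨v', ?_, by rw [hsyn] at hwv'; exact hwv'⟩
        have : v' + f = (v' + (f + g)) + g := by
          have hgg : g + g = 0 := by
            funext q; simp only [Pi.add_apply, Pi.zero_apply]
            exact (by decide : ∀ z : ZMod 2, z + z = 0) _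
          rw [add_assoc, add_assoc f, hgg, add_zero]
        rw [this]
        exact Submodule.add_mem _ hv' hgmem

/-! ### LTZ15 Corollary 9 for all degrees -/

/-- **Robustness, projection form (all degrees).** For a `(Δ_A,Δ_B)`-biregular `(γ_A,δ_A,γ_B,δ_B)`-expander with
`0 ≤ δ_A, δ_B < 1/6`: if the coset `e + C_Z^⊥` contains a word `e₀` whose projections satisfy `|(E₀)_A²| ≤ γ_A n_A` and
`|π₁(E₀ ∩ B²)| ≤ γ_B n_B`, it contains a word `e'` with `|e'| ≤ 3|σ_X(e)|` (i.e. `|σ_X(e)| ≥ w_R(e)/3`). STATUS: OURS — a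
hypothesis weaker than the printed `w_R(e) < min(γ_A n_A, γ_B n_B)` (projections instead of weight).
[cite: LeverrierTillichZemor2015, Cor 9 (arXiv v1 p0009 L9-11) with App. A (p0012 L20-27, L44-52)] -/
theorem ltz15_corollary9_proj (H : Matrix B A (ZMod 2)) {dA dB : ℕ} {γA δA γB δB : ℝ}
    (hreg : IsBiregular H dA dB) (hexp : IsLeftRightExpanding H dA dB γA δA γB δB)
    (hdA : 0 < dA) (hdB : 0 < dB) (hδA : 0 ≤ δA) (hδA' : δA < 1 / 6) (hδB : 0 ≤ δB) (hδB' : δB < 1 / 6)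
    {e e₀ : (A × A) ⊕ (B × B) → ZMod 2} (he₀ : e₀ + e ∈ rowSpace (expanderHZ H))
    (hA : ((projA (supp e₀)).card : ℝ) ≤ γA * Fintype.card A)
    (hB : ((projB (supp e₀)).card : ℝ) ≤ γB * Fintype.card B) :
    ∃ e' : (A × A) ⊕ (B × B) → ZMod 2, e' + e ∈ rowSpace (expanderHZ H) ∧
      hammingNorm e' ≤ 3 * hammingNorm (expanderHX H *ᵥ e) := by
  obtain ⟨f', hf', hwf'⟩ :=
    exists_coset_word_le_three_of_proj H hreg hexp hdA hdB hδA hδA' hδB hδB' e₀ hA hB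
  obtain ⟨hsyn, hmem⟩ := coset_transfer H he₀ hf'
  exact ⟨f', hmem, by rw [← hsyn]; exact hwf'⟩

/-- **LTZ15 Corollary 9 (Robustness) with the non-strict radius, ALL degrees**: for a `(Δ_A,Δ_B)`-biregular
`(γ_A,δ_A,γ_B,δ_B)`-expander with `0 ≤ δ_A, δ_B < 1/6` and any `Δ_A, Δ_B ≥ 1`, if `e + C_Z^⊥` contains a word `e₀` with
`|e₀| ≤ min(γ_A n_A, γ_B n_B)` then it contains a word of weight `≤ 3|σ_X(e)|`, i.e. `|σ_X(e)| ≥ w_R(e)/3` whenever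
`w_R(e) ≤ min(γ_A n_A, γ_B n_B)` (the printed corollary has `<`; Lemma 8's radius is `≤`). Proof: `|E_A²|, |π₁(E∩B²)| ≤ |e₀|`.
[cite: LeverrierTillichZemor2015, Cor 9 (arXiv v1 p0009 L9-31)] -/
theorem ltz15_corollary9_le (H : Matrix B A (ZMod 2)) {dA dB : ℕ} {γA δA γB δB : ℝ}
    (hreg : IsBiregular H dA dB) (hexp : IsLeftRightExpanding H dA dB γA δA γB δB)
    (hdA : 0 < dA) (hdB : 0 < dB) (hδA : 0 ≤ δA) (hδA' : δA < 1 / 6) (hδB : 0 ≤ δB) (hδB' : δB < 1 / 6)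
    {e e₀ : (A × A) ⊕ (B × B) → ZMod 2} (he₀ : e₀ + e ∈ rowSpace (expanderHZ H))
    (hw : (hammingNorm e₀ : ℝ) ≤ min (γA * Fintype.card A) (γB * Fintype.card B)) :
    ∃ e' : (A × A) ⊕ (B × B) → ZMod 2, e' + e ∈ rowSpace (expanderHZ H) ∧
      hammingNorm e' ≤ 3 * hammingNorm (expanderHX H *ᵥ e) := by
  have hsupp : (supp e₀).card = hammingNorm e₀ := by simp [supp, hammingNorm]
  have hA : ((projA (supp e₀)).card : ℝ) ≤ γA * Fintype.card A := by
    have h1 : ((projA (supp e₀)).card : ℝ) ≤ hammingNorm e₀ := by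
      rw [← hsupp]; exact_mod_cast card_projA_le (supp e₀)
    exact h1.trans (hw.trans (min_le_left _ _))
  have hB : ((projB (supp e₀)).card : ℝ) ≤ γB * Fintype.card B := by
    have h1 : ((projB (supp e₀)).card : ℝ) ≤ hammingNorm e₀ := by
      rw [← hsupp]; exact_mod_cast card_projB_le (supp e₀)
    exact h1.trans (hw.trans (min_le_right _ _))
  exact ltz15_corollary9_proj H hreg hexp hdA hdB hδA hδA' hδB hδB' he₀ hA hB

/-- ★ **LTZ15 Corollary 9 (Robustness), EXACTLY AS PRINTED, for ALL degree pairs `(Δ_A, Δ_B)`**: for a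
`(Δ_A,Δ_B)`-biregular `(γ_A,δ_A,γ_B,δ_B)`-left-right-expanding graph with `δ_A, δ_B < 1/6` (and `Δ_A, Δ_B ≥ 1`, `δ ≥ 0`),
"any error `e` with reduced weight `w_R(e) < min(γ_A n_A, γ_B n_B)` has a syndrome with weight bounded from below as
`|σ(e)| ≥ (1/3) w_R(e)`": if the coset `e + C_Z^⊥` contains a word `e₀` with `|e₀| < min(γ_A n_A, γ_B n_B)`, it contains a
word `e'` with `|e'| ≤ 3|σ_X(e)|`. This is the statement of the tree's `ltz15_corollary9_near_balanced` WITHOUT its added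
hypothesis `|Δ_A − Δ_B| ≤ 5`. STATUS: PRINTED statement; the proof (projection invariant, this file) is ours and differs
from the printed iteration, whose weight clause (Lemma 8 (ii)) is not used.
[cite: LeverrierTillichZemor2015, Cor 9 (arXiv v1 p0009 L9-11)] -/
theorem ltz15_corollary9 (H : Matrix B A (ZMod 2)) {dA dB : ℕ} {γA δA γB δB : ℝ}
    (hreg : IsBiregular H dA dB) (hexp : IsLeftRightExpanding H dA dB γA δA γB δB)
    (hdA : 0 < dA) (hdB : 0 < dB) (hδA : 0 ≤ δA) (hδA' : δA < 1 / 6) (hδB : 0 ≤ δB) (hδB' : δB < 1 / 6)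
    {e e₀ : (A × A) ⊕ (B × B) → ZMod 2} (he₀ : e₀ + e ∈ rowSpace (expanderHZ H))
    (hw : (hammingNorm e₀ : ℝ) < min (γA * Fintype.card A) (γB * Fintype.card B)) :
    ∃ e' : (A × A) ⊕ (B × B) → ZMod 2, e' + e ∈ rowSpace (expanderHZ H) ∧
      hammingNorm e' ≤ 3 * hammingNorm (expanderHX H *ᵥ e) :=
  ltz15_corollary9_le H hreg hexp hdA hdB hδA hδA' hδB hδB' he₀ hw.le

/-- The same with the hypotheses of `ltz15_corollary9_near_balanced` (`0 < δ`) minus `|Δ_A − Δ_B| ≤ 5`, for drop-in use.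
[cite: LeverrierTillichZemor2015, Cor 9 (arXiv v1 p0009 L9-11)] -/
theorem ltz15_corollary9_all_degrees (H : Matrix B A (ZMod 2)) {dA dB : ℕ} {γA δA γB δB : ℝ}
    (hreg : IsBiregular H dA dB) (hexp : IsLeftRightExpanding H dA dB γA δA γB δB)
    (hdA : 0 < dA) (hdB : 0 < dB) (hδA : 0 < δA) (hδA' : δA < 1 / 6) (hδB : 0 < δB) (hδB' : δB < 1 / 6)
    {e e₀ : (A × A) ⊕ (B × B) → ZMod 2} (he₀ : e₀ + e ∈ rowSpace (expanderHZ H))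
    (hw : (hammingNorm e₀ : ℝ) < min (γA * Fintype.card A) (γB * Fintype.card B)) :
    ∃ e' : (A × A) ⊕ (B × B) → ZMod 2, e' + e ∈ rowSpace (expanderHZ H) ∧
      hammingNorm e' ≤ 3 * hammingNorm (expanderHX H *ᵥ e) :=
  ltz15_corollary9 H hreg hexp hdA hdB hδA.le hδA' hδB.le hδB' he₀ hw

/-- **Projection form of LTZ15 Cor 5 (a by-product)**: an `X`-error with ZERO `σ_X`-syndrome whose projections satisfy
`|E_A²| ≤ γ_A n_A` and `|π₁(E ∩ B²)| ≤ γ_B n_B` is a `Z`-stabilizer element (`e ∈ C_Z^⊥`) — whatever its weight.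
Equivalently every non-trivial logical `X`-operator has a representative-independent obstruction: each of its
representatives has `|E_A²| > γ_A n_A` or `|π₁(E ∩ B²)| > γ_B n_B`. STATUS: OURS (Cor 5 printed: `d ≥ min(γ_A n_A, γ_B n_B)`).
[cite: LeverrierTillichZemor2015, Cor 5 (arXiv v1 p0008 L36-45) and Cor 9 proof, last step (p0009 L27-30)] -/
theorem mem_rowSpace_of_syndrome_eq_zero_of_proj (H : Matrix B A (ZMod 2)) {dA dB : ℕ} {γA δA γB δB : ℝ}
    (hreg : IsBiregular H dA dB) (hexp : IsLeftRightExpanding H dA dB γA δA γB δB)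
    (hdA : 0 < dA) (hdB : 0 < dB) (hδA : 0 ≤ δA) (hδA' : δA < 1 / 6) (hδB : 0 ≤ δB) (hδB' : δB < 1 / 6)
    {e : (A × A) ⊕ (B × B) → ZMod 2} (hσ : expanderHX H *ᵥ e = 0)
    (hA : ((projA (supp e)).card : ℝ) ≤ γA * Fintype.card A)
    (hB : ((projB (supp e)).card : ℝ) ≤ γB * Fintype.card B) :
    e ∈ rowSpace (expanderHZ H) := by
  obtain ⟨e', he', hw⟩ := exists_coset_word_le_three_of_proj H hreg hexp hdA hdB hδA hδA' hδB hδB' e hA hB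
  rw [hσ, hammingNorm_zero, mul_zero, Nat.le_zero, hammingNorm_eq_zero] at hw
  rw [hw, zero_add] at he'
  exact he'

/-- **LTZ15 Corollary 9 for `Z`-errors, as printed, ALL degrees**: for a `(Δ_A,Δ_B)`-biregular
`(γ_A,δ_A,γ_B,δ_B)`-expander with `δ_A, δ_B < 1/6`, if the coset `e + rowsp H_X` of a `Z`-error `e` contains a word of
weight `< min(γ_A n_A, γ_B n_B)`, it contains a word of weight `≤ 3|σ_Z(e)|` (`σ_Z(e) = H_Z e`). The `X`-sector statement
`ltz15_corollary9` for `Gᵀ`, transported along the block swap (`expanderHX_eq_submatrix_swap`, `expanderHZ_eq_submatrix_swap`).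
STATUS: PRINTED statement ("the `Z`-case by exchanging the roles of `A` and `B`"), all degrees.
[cite: LeverrierTillichZemor2015, Cor 9 (arXiv v1 p0009 L9-11) with §2 ("the situation for 𝒢_Z is obtained by exchanging the roles of A and B"; p0005)] -/
theorem ltz15_corollary9_zsector (H : Matrix B A (ZMod 2)) {dA dB : ℕ} {γA δA γB δB : ℝ}
    (hreg : IsBiregular H dA dB) (hexp : IsLeftRightExpanding H dA dB γA δA γB δB)
    (hdA : 0 < dA) (hdB : 0 < dB) (hδA : 0 ≤ δA) (hδA' : δA < 1 / 6) (hδB : 0 ≤ δB) (hδB' : δB < 1 / 6)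
    {e e₀ : (A × A) ⊕ (B × B) → ZMod 2} (he₀ : e₀ + e ∈ rowSpace (expanderHX H))
    (hw : (hammingNorm e₀ : ℝ) < min (γA * Fintype.card A) (γB * Fintype.card B)) :
    ∃ e' : (A × A) ⊕ (B × B) → ZMod 2, e' + e ∈ rowSpace (expanderHX H) ∧
      hammingNorm e' ≤ 3 * hammingNorm (expanderHZ H *ᵥ e) := by
  set σ := Equiv.sumComm (A × A) (B × B) with hσ
  rw [expanderHX_eq_submatrix_swap H] at he₀ ⊢
  rw [expanderHZ_eq_submatrix_swap H, mem_rowSpace_submatrix_iff] at *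
  have hregT : IsBiregular Hᵀ dB dA := isBiregular_transpose H hreg
  have hexpT : IsLeftRightExpanding Hᵀ dB dA γB δB γA δA := by
    refine ⟨(isLeftExpanding_transpose_iff H dB γB δB).2 hexp.2, ?_⟩
    have h : IsLeftExpanding Hᵀᵀ dA γA δA := by rw [Matrix.transpose_transpose]; exact hexp.1
    exact (isLeftExpanding_transpose_iff Hᵀ dA γA δA).1 h
  have he₀' : e₀ ∘ σ.symm + e ∘ σ.symm ∈ rowSpace (expanderHZ Hᵀ) := he₀
  have hw' : (hammingNorm (e₀ ∘ σ.symm) : ℝ) < min (γB * Fintype.card B) (γA * Fintype.card A) := by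
    rw [hammingNorm_comp_equiv, min_comm]; exact hw
  obtain ⟨f', hf', hwf'⟩ := ltz15_corollary9 Hᵀ hregT hexpT hdB hdA hδB hδB' hδA hδA' he₀' hw'
  refine ⟨f' ∘ σ, ?_, ?_⟩
  · rw [mem_rowSpace_submatrix_iff]
    have : (f' ∘ σ + e) ∘ σ.symm = f' + e ∘ σ.symm := by
      funext q; simp [Function.comp_apply]
    rw [this]; exact hf'
  · rw [submatrix_mulVec_eq]
    have : hammingNorm (f' ∘ ⇑σ) = hammingNorm f' := by
      have h := hammingNorm_comp_equiv (f' ∘ σ) σ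
      rw [← h]; congr 1; funext q; simp
    rw [this]; exact hwf'

end QuantumExpander

end Literature.InformationTheory.QuantumCodes
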